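import Mathlib.FieldTheory.KummerPolynomial
import Mathlib.RingTheory.AdjoinRoot
import Mathlib.Algebra.CharP.Algebra
import HarnessLib

/-!
# D3a part 5 (frame): the field `L = κ(√h₀)` of the LOW tower
(res-D-pv-012 AS res-L0-w41-stub-8; W4.1 crux `Steer`, LOW branch, strat-2 §σ2.24 `IsLowTowerTwo` clauses (T0)/(T2).) OURS; AI.

For a field `κ` and a non-square `h₀ ∈ κ`, a quadratic field extension `L ⊇ κ` with a square root `T₀` of `h₀` and `L = κ ⊕ κ T₀`
(`exists_quadratic_extension`; `L := κ[X]/(X² − h₀)`), inheriting the characteristic (`charP_of_algebra`).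
-/

noncomputable section
set_option linter.dupNamespace false

namespace Summit.ResolutionOfSingularities.ResolutionOfSingularities.Theorems.SwitchingDichotomy.LowTower

open Polynomial

/-- **The quadratic field `κ(√h₀)`**: for a non-square `h₀` of a field `κ` there is an algebraic field extension `L/κ` with `T₀ ∈ L`,
`T₀² = h₀`, every element of which is `c + d·T₀` with `c, d ∈ κ`. [folklore] -/
theorem exists_quadratic_extension (κ : Type) [Field κ] (h₀ : κ) (hns : ∀ c : κ, c ^ 2 ≠ h₀) :
    ∃ (L : Type) (_ : Field L) (_ : Algebra κ L), Algebra.IsAlgebraic κ L ∧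
      ∃ T₀ : L, T₀ ^ 2 = algebraMap κ L h₀ ∧ ∀ z : L, ∃ c d : κ, z = algebraMap κ L c + algebraMap κ L d * T₀ := by
  set f : κ[X] := X ^ 2 - C h₀ with hf
  have hirr : Irreducible f := X_pow_sub_C_irreducible_of_prime Nat.prime_two hns
  haveI : Fact (Irreducible f) := ⟨hirr⟩
  have hmonic : f.Monic := monic_X_pow_sub_C h₀ two_ne_zero
  have hf0 : f ≠ 0 := hmonic.ne_zero
  refine ⟨AdjoinRoot f, inferInstance, inferInstance, ?_, AdjoinRoot.root f, ?_, fun z => ?_⟩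
  · haveI : Module.Finite κ (AdjoinRoot f) := (AdjoinRoot.powerBasis hf0).finite
    exact Algebra.IsAlgebraic.of_finite κ (AdjoinRoot f)
  · have h := AdjoinRoot.eval₂_root f
    rw [hf, eval₂_sub, eval₂_X_pow, eval₂_C, sub_eq_zero] at h
    exact h
  · obtain ⟨p, rfl⟩ := AdjoinRoot.mk_surjective z
    set r := p %ₘ f with hr
    have hdeg : r.degree ≤ 1 := by
      have h := degree_modByMonic_lt p hmonic
      have hfd : f.degree = 2 := by rw [hf]; exact degree_X_pow_sub_C (by norm_num) h₀
      rw [hfd] at h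
      exact Order.le_of_lt_succ (by exact_mod_cast h)
    have hpr : AdjoinRoot.mk f p = AdjoinRoot.mk f r := by
      have h := AdjoinRoot.mk_leftInverse hmonic (AdjoinRoot.mk f p)
      rw [AdjoinRoot.modByMonicHom_mk] at h
      rw [hr, h]
    obtain ⟨c, d, hcd⟩ : ∃ c d : κ, r = C d * X + C c := ⟨r.coeff 0, r.coeff 1, eq_X_add_C_of_degree_le_one hdeg⟩
    refine ⟨c, d, ?_⟩
    rw [hpr, hcd]
    simp only [map_add, map_mul, AdjoinRoot.mk_C, AdjoinRoot.mk_X, AdjoinRoot.algebraMap_eq]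
    ring

/-- A field extension of a field of characteristic `p` has characteristic `p`. [folklore] -/
theorem charP_of_algebra (κ L : Type) [Field κ] [Field L] [Algebra κ L] (p : ℕ) [CharP κ p] : CharP L p :=
  charP_of_injective_algebraMap (algebraMap κ L).injective p

end Summit.ResolutionOfSingularities.ResolutionOfSingularities.Theorems.SwitchingDichotomy.LowTower

end
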